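import Summits.AtomisticToContinuum.HydrodynamicLimit.Theorems.OneFlightGossipEngineEnergyCurrentTailsPedigreeCircularity
import Summits.AtomisticToContinuum.HydrodynamicLimit.Theorems.OneFlightGossipEngineEnergyCurrentTailsPedigreeAssemblyOrderFour
import Summits.AtomisticToContinuum.HydrodynamicLimit.Theorems.OneFlightGossipEngineEnergyCurrentTailsPedigreeLedgerSure
import Summits.AtomisticToContinuum.HydrodynamicLimit.Theorems.OneFlightGossipEngineEnergyCurrentTailsPedigreeMeasurable
import Summits.AtomisticToContinuum.HydrodynamicLimit.Theorems.OneFlightGossipEngineEnergyCurrentTailsPedigreeLevelInclusion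
import Summits.AtomisticToContinuum.HydrodynamicLimit.Theorems.OneFlightGossipEngineEnergyCurrentTailsPedigreeDataTails
import HarnessLib

/-!
# The merge channel at order 4 is equivalent to the census
# (line `pedigree-perpetuity`, crux `EnergyCurrentTails`, stmt-AtomisticToContinuum-9235)

Registered helper `censusDecay_iff_mergeIntakeTailsOrder_four : NeutralRunTails → (CensusDecay ↔
MergeIntakeTailsOrder 4)` (lead c3; this file by the lead's c3 worker).  It closes the loop between

* the cycle-1 finding of the line, `mergeIntakeTailsOrder_four_of_censusDecay : CensusDecay →
  MergeIntakeTailsOrder 4` (`…PedigreeCircularity`: the merge channel is census-strength — sure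
  domination of the discounted warm intake by the present energy, exchangeability, census bound), and
* the order-4 census assembly `censusDecay_of_mergeIntakeTailsOrder_four : LineageLedger →
  LevelInclusion → InitialEnergyTails → NeutralRunTails → MergeIntakeTailsOrder 4 → CensusDecay`
  (`…PedigreeAssemblyOrderFour`), fed with the landed sure ledger `stub_lineageLedgerSure`, the
  a.e.-measurability `stub_lineageMeasurable`, the level inclusion `stub_levelInclusion` and the data
  tails `stub_initialEnergyTails`.

So, modulo the annealed run statistics `NeutralRunTails`, pricing the merge channel of this line at the
order the assembly consumes IS proving the line's transfer statement `CensusDecay`.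
-/

noncomputable section

namespace Summit.AtomisticToContinuum.HydrodynamicLimit.Theorems.EnergyCurrentTailsPedigree

/-- **The merge channel at order 4 is equivalent to the census** (registered helper
`censusDecay_iff_mergeIntakeTailsOrder_four`, line `pedigree-perpetuity`, lead c3): given the annealed run
statistics `NeutralRunTails`, the line's transfer statement `CensusDecay` holds iff the merge-intake tail
bound of order 4 does — (→) by the census-strength of the merge channel
(`mergeIntakeTailsOrder_four_of_censusDecay`), (←) by the order-4 census assembly
`censusDecay_of_mergeIntakeTailsOrder_four` fed with the landed ledger (`stub_lineageLedgerSure`,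
`stub_lineageMeasurable`), level inclusion (`stub_levelInclusion`) and data tails (`stub_initialEnergyTails`). -/
theorem censusDecay_iff_mergeIntakeTailsOrder_four : NeutralRunTails → (CensusDecay ↔ MergeIntakeTailsOrder 4) :=
  fun hRuns => ⟨mergeIntakeTailsOrder_four_of_censusDecay, fun hM =>
    censusDecay_of_mergeIntakeTailsOrder_four (lineageLedger_of stub_lineageLedgerSure stub_lineageMeasurable)
      (stub_levelInclusion stub_lineageLedgerSure) stub_initialEnergyTails hRuns hM⟩

end Summit.AtomisticToContinuum.HydrodynamicLimit.Theorems.EnergyCurrentTailsPedigree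

end
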